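import Literature.MathematicalPhysics.QuantumFieldTheory.Balaban1983to89.B6GOneLevelV1Bridge
import Literature.MathematicalPhysics.QuantumFieldTheory.Balaban1983to89.B5Eq190FlatCoercivityUniform
import Literature.MathematicalPhysics.QuantumFieldTheory.Balaban1983to89.T3ContinuumYM3Torus
import HarnessLib

/-!
# Route `UnitScaleTilt`, crux K1 child «MinimiserStabilityRegPr» (stmt-QuantumFields-19200), registered stub `stub_prop7From14` (skeleton birth_v5
# 98cb23610ad7; leaf V3 «Prop 7 from a background (14)») — sub-lemma V3-D1b′ AT THE FLAT BACKGROUND: [Balaban1984PropagatorsI] PROP. 1.1 (1.90)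
# **WITH PRINT'S RESIDUAL-GAUGE PROJECTION `R`** ON THE SETUP TORUS, `k`-UNIFORM AND VOLUME-FREE —
# `γ(d,a)·‖A‖² ≤ ‖∂A‖² + ‖R∂^*A‖² + a·L^{kd}·‖Q_kA‖²`, `γ(d,a) = 1/((d+1)·Cst d a)`

Cell `ym3-torus` ∕ fleet seat `ym-ust-19200-p1` (gen 3; HUMAN RULING D-0037, YM ladder rung R3).  WHY.  The uniqueness clause of
[Balaban1985Variational] Prop. 7 at the d = 3 carrier reduces (this seat's `Prop7UniquenessReduction`, p504929) to a gauge chart inside print's group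
(4) (`u↓ = 1`) and strict growth of the action along that chart.  The group (4) has `(#sites − #blocks)·dim 𝔤` parameters, so its Landau slice is
print's (21) `R(U₀)D^*_{U₀}A = 0` with the projection `R = I − Δ⁻¹Q′^*(Q′Δ⁻²Q′^*)⁻¹Q′Δ⁻¹` of [Balaban1984PropagatorsI] (1.70)–(1.72) — NOT the full
Landau condition `D^*A = 0` under which the item's flat engine was proved (`Prop7FlatCoercivity.curl_sq_ge_of_landau_of_bondAvgIter_eq_zero_T3`,
p454029).  The growth therefore needs [Balaban1985BackgroundPropagators] Thm 3.11 in the form with the `DRD^*` term; its flat case is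
[Balaban1984PropagatorsI] Prop. 1.1 (1.90) «Δ_a = G⁻¹ ≧ γ₀(Δ + I) … with a positive constant γ₀ independent of k, T_η».  THAT INEQUALITY IS
KERNEL-CERTIFIED IN THE TREE on the [B5] torus carrier (pub-balaban b05: `B5DeltaA169.smul_LapOne_le_DeltaA`, read as a form inequality in
`B5Eq190FlatCoercivityUniform.b05_form_lower`), and the one-level OPERATOR BRIDGE to the V1 vector model on the Setup torus exists
(`B6GOneLevelV1Bridge.form_deltaAE`: «(2.19) = (1.69)», lit-balaban r03).  This file composes the two: (1.90) with print's `R`, for real bond fields on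
`Site P 0`, any `Params`, any `j` with one level above (`j + 1 ≤ m + K`), and its instance at the d = 3 carrier — 60 lines of bookkeeping whose value
is the LOCATION: V3-D1b′-flat is not a new proof but a bridge, now in the item's own vocabulary.

WHAT IS PROVED (sorry-free, no definition; nothing of the papers asserted — (1.90) enters as the tree THEOREM `b05_form_lower`).
* `inner_deltaAE_twoScale_empty_ge`: for the one-level structure `twoScale j hj ∅` of `B6SectCTwoScaleV1` (all `Ω_i = T_η`, `Λ′ = ∅`; constraints =
  the bonds of `T^{(j)}`), lattice factor `L^j`, weight `a·L^{jd}`: `γ(d,a)·‖x‖² ≤ ⟪x, Δ_a x⟫`, `Δ_a = B6SectAVectorModelV1.deltaAE` ((2.19) =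
  `∂^*∂ + ∂R∂^* + Q^*aQ`).
* **`flat_coercive_R`** (three squares, `LatticeFieldCalculus` letters): `γ(d,a)·Σ_b A(b)² ≤ Σ_p (curl (L^j) A p)² + ‖R ∂^*A‖² + a·L^{jd}·Σ_c (Q_jA)(c)²`,
  `Q_j = bondAvgIter j`, `∂^* = diverg (L^j)` (inside `dsE`), `R = B6SectAOperatorsV1.RE` (= (1.70)'s `I − P` on the torus by `B6ProjR212TorusBridge`).
* **`flat_coercive_R_T3`**: the d = 3 carrier of `T3Thm1Carrier.varProblem3 F n K` (fine torus `Site (F.P K) 0`, `j = K − n`, one more level by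
  `m ≥ 1`): `γ(3,a) = 1/(4·Cst 3 a)`, uniform in `m`, `n`, `K`.

HONEST SCOPE / WHAT THIS IS NOT.  Flat background only (the small-field version with `R(U₀)`, `Q(U₀)` — Thm 3.11 proper — is the NE9 chain's
`B9Thm311SmallFieldCoercivityUniform` for ONE step with `η`-dependent constants, or a plaquette-only perturbation of this file in the style of the
item's `Prop7CovariantCoercivity` files: open); the lattice factor `L^j` is kept inside `curl`∕`diverg` (divide by `L^{2j}` for the `η² = L^{−2j}`
rate); the constant `Cst d a` is b05's ([B5] Prop. 1.1's `γ₀⁻¹`, explicit but not evaluated).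

References: T. Bałaban, CMP 95 (1984) 17–40 [Balaban1984PropagatorsI] (Prop. 1.1 (1.89)–(1.90) p.33, (1.69)–(1.72) pp.29–30); CMP 96 (1984) 223–250
[Balaban1984PropagatorsII] ((2.17)–(2.19) p.226, (2.90) p.239); CMP 99 (1985) 389–434 [Balaban1985BackgroundPropagators] (Thm 3.11 p.416); CMP 102
(1985) 277–309 [Balaban1985Variational] ((21) p.281, Prop. 7 p.299).
-/

noncomputable section

open scoped BigOperators InnerProductSpace Matrix ComplexConjugate

namespace Summit.QuantumFields.YangMills.Theorems.Prop7FlatCoercivityR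

open Literature.MathematicalPhysics.QuantumFieldTheory.Balaban1983to89
open LatticeFieldCalculus B6SectADomainsV1 B6SectAOperatorsV1 B6SectAVectorModelV1 B6SectCTwoScaleV1 B6GOneLevelV1Bridge
open B6ProjR212TorusBridge (QpE_twoScale_empty_eq_zero_iff)
open B5Eq117TorusCarriers (Mk)
open B5Prop11Plancherel (Tor fine)
open B5DeltaA169 (DeltaA)
open Literature.MathematicalPhysics.QuantumFieldTheory.BalabanImbrieJaffe1984to88.BIJ85AxialPropagator411 (BondSpace PlaqSpace)

variable {P : Params} {j : ℕ}

/-- The square norm of a complex vector as the real part of its self-pairing. [folklore] -/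
theorem sum_norm_sq_eq_re_dotProduct {ι : Type*} [Fintype ι] (v : ι → ℂ) :
    ∑ i, ‖v i‖ ^ 2 = (star v ⬝ᵥ v).re := by
  simp only [dotProduct, Pi.star_apply, Complex.star_def, Complex.re_sum, Complex.conj_mul', ← Complex.ofReal_pow,
    Complex.ofReal_re]

/-- **[Balaban1984PropagatorsI] PROP. 1.1 (1.90) WITH PRINT'S RESIDUAL-GAUGE PROJECTION `R`, AT THE SETUP TORUS, UNIFORMLY IN `k` AND IN THE
VOLUME**: for the one-level structure (all `Ω_i` the whole torus, `Λ′ = ∅`, constraints = the bonds of `T^{(j)}`) with lattice factor `L^j` and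
weight `a·L^{jd}` on the constraints, `γ(d,a)·‖A‖² ≤ ⟨A, Δ_aA⟩`, `Δ_a = ∂^*∂ + ∂R∂^* + Q^*aQ` the V1 operator (2.19) of
`B6SectAVectorModelV1.deltaAE`, `γ(d,a) = 1/((d+1)·Cst d a)` — b05's kernel-certified (1.90) (`B5Eq190FlatCoercivityUniform.b05_form_lower`)
read through the one-level bridge `B6GOneLevelV1Bridge.form_deltaAE`. [cite: Balaban1984PropagatorsI, Prop. 1.1 (1.90) p.33] -/
theorem inner_deltaAE_twoScale_empty_ge (hj1 : j + 1 ≤ P.m + P.K) {a : ℝ} (ha : 0 < a)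
    {w : BondIdx (twoScale j hj1 (∅ : Finset (Site P (j + 1)))) → ℝ} (hwa : ∀ p, w p = a * ((P.L : ℝ) ^ j) ^ P.d)
    (x : BondSpace P) :
    (1 / ((P.d + 1 : ℝ) * B5Prop11Plancherel.Cst P.d a)) * ‖x‖ ^ 2
      ≤ ⟪x, deltaAE (twoScale j hj1 ∅) ((P.L : ℝ) ^ j) w x⟫_ℝ := by
  have hj : j ≤ P.m + P.K := Nat.le_of_succ_le hj1
  have hn : 1 ≤ P.L ^ j := Nat.one_le_pow _ _ P.L_pos
  have h1 := form_deltaAE hj (twoScale j hj1 ∅) (QpE_twoScale_empty_eq_zero_iff hj1) ha (hQ_twoScale_empty hj1 hwa) x x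
  have h2 := B5Eq190FlatCoercivityUniform.b05_form_lower (P.L ^ j) (Mk P j) hn ha (TV hj x)
  have h3 : ∑ w', ‖TV hj x w'‖ ^ 2 = ‖x‖ ^ 2 := by
    rw [sum_norm_sq_eq_re_dotProduct, star_TV_dotProduct_TV, Complex.ofReal_re, real_inner_self_eq_norm_sq]
  rw [h3] at h2
  have h4 : (star (TV hj x) ⬝ᵥ (DeltaA (P.L ^ j) (Mk P j) a).mulVec (TV hj x)).re
      = ⟪x, deltaAE (twoScale j hj1 ∅) ((P.L : ℝ) ^ j) w x⟫_ℝ := by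
    rw [h1, Complex.ofReal_re]
  rw [← h4]
  exact h2

/-- **THE SAME, THREE SQUARES UNPACKED IN THE VOCABULARY OF `LatticeFieldCalculus`**: for every real bond field `A` on the finest torus and every
`j` with `j + 1 ≤ m + K`,
`γ(d,a)·Σ_b A(b)² ≤ Σ_p (curl (L^j) A p)² + ‖R ∂^*A‖² + a·L^{jd}·Σ_c (Q_jA)(c)²`
(`Q_j = bondAvgIter j`, `∂^* = diverg (L^j)`, `R` = the one-level residual projection `B6SectAOperatorsV1.RE` of [Balaban1984PropagatorsII] (2.17) =
[Balaban1984PropagatorsI] (1.70)–(1.72) `I − Δ⁻¹Q′^*(Q′Δ⁻²Q′^*)⁻¹Q′Δ⁻¹`, `B6ProjR212TorusBridge`) — the flat engine of [Balaban1985BackgroundPropagators]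
Thm 3.11 WITH the `∂R∂^*` gauge term the Landau chart of [Balaban1985Variational] (21) lives on, constants independent of `j` and of the volume.
[cite: Balaban1984PropagatorsI, Prop. 1.1 (1.90) p.33, (1.69) p.29] -/
theorem flat_coercive_R (hj1 : j + 1 ≤ P.m + P.K) {a : ℝ} (ha : 0 < a) (x : BondSpace P) :
    (1 / ((P.d + 1 : ℝ) * B5Prop11Plancherel.Cst P.d a)) * ∑ b : PBond P 0, (x b) ^ 2
      ≤ ∑ p : Plaq P 0, (curl ((P.L : ℝ) ^ j) (WithLp.ofLp x) p) ^ 2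
        + ‖RE (twoScale j hj1 (∅ : Finset (Site P (j + 1)))) ((P.L : ℝ) ^ j) (dsE ((P.L : ℝ) ^ j) x)‖ ^ 2
        + a * ((P.L : ℝ) ^ j) ^ P.d * ∑ c : PBond P j, (bondAvgIter j (WithLp.ofLp x) c) ^ 2 := by
  have h := inner_deltaAE_twoScale_empty_ge hj1 ha (w := fun _ => a * ((P.L : ℝ) ^ j) ^ P.d) (fun _ => rfl) x
  rw [inner_deltaAE_self] at h
  have hx : ‖x‖ ^ 2 = ∑ b : PBond P 0, (x b) ^ 2 := by
    rw [EuclideanSpace.norm_sq_eq]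
    exact Finset.sum_congr rfl fun b _ => by rw [Real.norm_eq_abs, sq_abs]
  have hcurl : ‖dcE ((P.L : ℝ) ^ j) x‖ ^ 2 = ∑ p : Plaq P 0, (curl ((P.L : ℝ) ^ j) (WithLp.ofLp x) p) ^ 2 := by
    rw [EuclideanSpace.norm_sq_eq]
    exact Finset.sum_congr rfl fun p _ => by rw [Real.norm_eq_abs, sq_abs, dcE_apply]
  have hQ : ∑ i, (fun _ => a * ((P.L : ℝ) ^ j) ^ P.d) i * QE (twoScale j hj1 ∅) x i ^ 2
      = a * ((P.L : ℝ) ^ j) ^ P.d * ∑ c : PBond P j, (bondAvgIter j (WithLp.ofLp x) c) ^ 2 := by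
    rw [sum_bondIdx_twoScale_empty hj1, Finset.mul_sum]
    refine Finset.sum_congr rfl fun c _ => ?_
    rw [QE_apply]
    rfl
  rw [hx, hcurl, hQ] at h
  exact h


/-- The fine torus of run `K` of the T³ family sits `K − n` levels above the comparison lattice, with one more level available (`m ≥ 1`).
[cite: Balaban1985UV3, (1)-(3) p.256] -/
theorem succ_le_T3 (F : T3ContinuumYM3Torus.T3Family) (n K : ℕ) : K - n + 1 ≤ (F.P K).m + (F.P K).K := by
  have := F.hm
  show K - n + 1 ≤ F.m + K
  omega

/-- **AT THE d = 3 CARRIER** of `T3Thm1Carrier.varProblem3 F n K` (fine torus `Site (F.P K) 0`, `k = K − n` averaging levels, lattice factor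
`L^{K−n} = η⁻¹`): `γ(3,a)·Σ_b A(b)² ≤ Σ_p (curl (L^{K−n}) A p)² + ‖R∂^*A‖² + a·L^{3(K−n)}·Σ_c (Q_{K−n}A)(c)²` for every real bond field `A`,
`γ(3,a) = 1/(4·Cst 3 a)` INDEPENDENT of `m`, `n`, `K` — [Balaban1984PropagatorsI] (1.90) = the flat case of [Balaban1985BackgroundPropagators] Thm 3.11
with print's residual Landau term `∂R∂^*`, the engine the chart (21) of [Balaban1985Variational] needs (the item's earlier flat engine,
`Prop7FlatCoercivity.curl_sq_ge_of_landau_of_bondAvgIter_eq_zero_T3`, has the FULL divergence instead).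
[cite: Balaban1984PropagatorsI, Prop. 1.1 (1.90) p.33; Balaban1985BackgroundPropagators, Thm 3.11 p.416] -/
theorem flat_coercive_R_T3 (F : T3ContinuumYM3Torus.T3Family) (n K : ℕ) {a : ℝ} (ha : 0 < a) (x : BondSpace (F.P K)) :
    (1 / ((3 + 1 : ℝ) * B5Prop11Plancherel.Cst 3 a)) * ∑ b : PBond (F.P K) 0, (x b) ^ 2
      ≤ ∑ p : Plaq (F.P K) 0, (curl ((F.L : ℝ) ^ (K - n)) (WithLp.ofLp x) p) ^ 2
        + ‖RE (twoScale (K - n) (succ_le_T3 F n K) (∅ : Finset (Site (F.P K) (K - n + 1)))) ((F.L : ℝ) ^ (K - n))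
            (dsE ((F.L : ℝ) ^ (K - n)) x)‖ ^ 2
        + a * ((F.L : ℝ) ^ (K - n)) ^ 3 * ∑ c : PBond (F.P K) (K - n), (bondAvgIter (K - n) (WithLp.ofLp x) c) ^ 2 := by
  have h := flat_coercive_R (P := F.P K) (succ_le_T3 F n K) ha x
  have hd : ((F.P K).d : ℝ) = 3 := by norm_num [show (F.P K).d = 3 from rfl]
  rw [hd] at h
  exact h

end Summit.QuantumFields.YangMills.Theorems.Prop7FlatCoercivityR

end
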